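import Mathlib
import Literature.Analysis.FluidPDE.SuitableWeakRightContinuity
import Summits.NavierStokesRegularity.NavierStokesRegularity.Theorems.EulerZoomLiouvillePowerGaugeEulerLiouvilleConfinedTools
import Summits.NavierStokesRegularity.NavierStokesRegularity.Theorems.EulerZoomLiouvillePowerGaugeEulerLiouvilleSelfSimilarProfileMember
import HarnessLib

/-!
# THE WINDOW IDENTITY OF CONSERVATIVE MEMBERS (line `lions_gate`, stub O2 `stub_windowIdentity`, by name; crux = stmt-NavierStokesRegularity-19832)

Route `EulerZoomLiouville` (NavierStokesRegularity); width seat ns-ezl-w6 g2 (LEAD ns-typeII-p2 g12; line `lions_gate` of ns-idea-11 «welcome as width by name»,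
2026-08-28T15:23Z).  A member of Seregin's class with the local energy EQUALITY (`IsEnergyConservative u p`) has the EXACT WINDOW IDENTITY (`HasWindowIdentity u p`):
for every smooth compactly supported `χ` there is a null set of times outside which `∫ χ|u(σ)|² − ∫ χ|u(s)|² = ∫_s^σ ∫ (|u|² + 2p)⟪u, ∇χ⟫` for all `s < σ < 0`
— `WindowIdentity.hasWindowIdentity_of_isEnergyConservative` (bodies of `InClass`, `IsEnergyConservative`, `HasWindowIdentity` verbatim).  Proof = the two-sided
twin of the tree's `SuitableRestart.ae_energy_le_of_start_Ioo` (Lemarié-Rieusset 2016 p. 568; CKN (2.5) sliced): test with `θₙ(t)χ(x)`, `θₙ = η^σ_n − η^s_n` from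
`exists_time_cutoff` (`∂ₜ(θₙχ) = (k^s_n − k^σ_n)χ`), `n → ∞` at Lebesgue points of `U(τ) = ∫χ|u(τ)|²` (`tendsto_integral_kernel_mul_of_lebesguePoint`, dominated
convergence with `tendsto_cutoff_indicator`); null set = non-Lebesgue points of `U` on a countable exhaustion of `(−∞,0)`; `|u|³ ∈ L¹_loc` from the `E`-gauge.
Also: classical members and the CIV needle are conservative and have the window identity (CKN "(2.5) with equality", `local_energy_eq_of_contDiffOn`).
WHAT THIS IS NOT: not NS, not E — bookkeeping for the conservative/dissipative split of the crux CLASS on the MODEL lattice (`--supports` stmt-19832); O1 (the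
Lions gate) and the cores O3/O4 are NOT touched; 19832 OPEN. [folklore; CaffarelliKohnNirenberg1982 §2 (2.5); LemarieRieusset2016 Thm 15.4 p.568]
-/

noncomputable section

set_option linter.dupNamespace false -- flat `Theorems/<Route><Decl>…` files share the crux namespace `Summit.<S>.<S>.…`

open MeasureTheory Set Filter Topology Metric Function TopologicalSpace InnerProductSpace
open scoped ENNReal NNReal RealInnerProductSpace

namespace Summit.NavierStokesRegularity.NavierStokesRegularity.Theorems.PowerGaugeEulerLiouville

open Literature.Analysis Literature.Analysis.FunctionSpaces Literature.Analysis.FluidPDE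

namespace WindowIdentity

variable {E : Type*} [NormedAddCommGroup E] [InnerProductSpace ℝ E] [FiniteDimensional ℝ E] [MeasurableSpace E] [BorelSpace E]
  {Q : Opens (ℝ × E)} {u : ℝ → E → E} {p : ℝ → E → ℝ}

/-- **CORE STEP on a compact time window.**  Let `(u, p)` be a suitable weak Euler pair (`ν = 0`, `f = 0`) on an open `Q ⊇ (a, b) × E` with `|u|³ ∈ L¹_loc(Q)`,
satisfying the local energy EQUALITY against every space–time test function on `Q`, and `χ` a smooth compactly supported function of `x`.  For
`a < a' < b' < b` there is a null set `N` of times such that for all `s < σ` in `(a', b')` outside `N`,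
`∫ |u(σ)|² χ − ∫ |u(s)|² χ = ∫_{[s,σ) × E} (|u|² + 2p)⟪u, ∇χ⟫`. [folklore] -/
theorem exists_null_window_identity_Ioo (hs : IsSuitableWeakSolutionOn Q 0 0 u p)
    (hu3 : LocallyIntegrableOn (fun z : ℝ × E => ‖u z.1 z.2‖ ^ 3) (Q : Set (ℝ × E)) volume)
    (hcons : ∀ φ : ℝ → E → ℝ, IsSpaceTimeTestOn Q φ →
      ∫ t, ∫ x, (‖u t x‖ ^ 2 * timeDeriv φ t x + (‖u t x‖ ^ 2 + 2 * p t x) * ⟪u t x, gradient (φ t) x⟫) = 0)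
    {a b : ℝ} (hab : Ioo a b ×ˢ (univ : Set E) ⊆ (Q : Set (ℝ × E)))
    {χ : E → ℝ} (hχ : ContDiff ℝ (⊤ : ℕ∞) χ) (hχc : HasCompactSupport χ) {a' b' : ℝ} (ha' : a < a') (hb' : b' < b) :
    ∃ N : Set ℝ, volume N = 0 ∧ ∀ s σ : ℝ, s ∈ Ioo a' b' → σ ∈ Ioo a' b' → s ∉ N → σ ∉ N → s < σ →
      (∫ x, χ x * ‖u σ x‖ ^ 2) - (∫ x, χ x * ‖u s x‖ ^ 2) =
        ∫ z in Ico s σ ×ˢ (univ : Set E), (‖u z.1 z.2‖ ^ 2 + 2 * p z.1 z.2) * ⟪u z.1 z.2, gradient χ z.2⟫ := by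
  -- ## the compact box `K = [a', b'] × tsupport χ` and the integrands
  set K : Set (ℝ × E) := Icc a' b' ×ˢ tsupport χ with hK
  have hKc : IsCompact K := isCompact_Icc.prod hχc
  have hIcc : Icc a' b' ⊆ Ioo a b := fun t ht => ⟨ha'.trans_le ht.1, ht.2.trans_lt hb'⟩
  have hKQ : K ⊆ (Q : Set (ℝ × E)) := (prod_mono hIcc (subset_univ _)).trans hab
  have hKm : MeasurableSet K := hKc.measurableSet
  set F : ℝ × E → ℝ := fun z => χ z.2 * ‖u z.1 z.2‖ ^ 2 with hF
  set R : ℝ × E → ℝ := fun z => (‖u z.1 z.2‖ ^ 2 + 2 * p z.1 z.2) * ⟪u z.1 z.2, gradient χ z.2⟫ with hR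
  have hFout : ∀ z : ℝ × E, z.2 ∉ tsupport χ → F z = 0 := fun z hz => by simp only [hF, image_eq_zero_of_notMem_tsupport hz, zero_mul]
  have hRout : ∀ z : ℝ × E, z.2 ∉ tsupport χ → R z = 0 := fun z hz => by
    simp only [hR, gradient_eq_zero_of_notMem_tsupport hz, inner_zero_right, mul_zero]
  have hu2 : LocallyIntegrableOn (fun z : ℝ × E => ‖u z.1 z.2‖ ^ 2) (Q : Set (ℝ × E)) volume := hs.distributional.2.1
  have hFK : IntegrableOn F K volume :=
    (hu2.integrableOn_compact_subset hKQ hKc).continuousOn_mul (hχ.continuous.comp continuous_snd).continuousOn hKc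
  have hRK : IntegrableOn R K volume := by
    refine (IntegrableOn.congr_fun (SuitableRestart.integrableOn_energyRHS_Icc_prod hs hu3 hab hχ hχc hIcc) (fun z _ => ?_)
      (measurableSet_Icc.prod MeasurableSet.univ)).mono_set (Set.prod_mono Subset.rfl (subset_univ _))
    simp only [hR, zero_mul, mul_zero, zero_add]
  set W : ℝ × E → ℝ := K.indicator F with hW
  set RK : ℝ × E → ℝ := K.indicator R with hRKdef
  have hIW : Integrable W (volume : Measure (ℝ × E)) := hFK.integrable_indicator hKm
  have hIRK : Integrable RK (volume : Measure (ℝ × E)) := hRK.integrable_indicator hKm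
  have hWF : ∀ z : ℝ × E, z.1 ∈ Icc a' b' → W z = F z := fun z hz => by
    by_cases hz2 : z.2 ∈ tsupport χ
    · exact indicator_of_mem (mem_prod.2 ⟨hz, hz2⟩) F
    · rw [hW, indicator_of_notMem (fun h => hz2 (mem_prod.1 h).2), hFout z hz2]
  have hRKR : ∀ z : ℝ × E, z.1 ∈ Icc a' b' → RK z = R z := fun z hz => by
    by_cases hz2 : z.2 ∈ tsupport χ
    · exact indicator_of_mem (mem_prod.2 ⟨hz, hz2⟩) R
    · rw [hRKdef, indicator_of_notMem (fun h => hz2 (mem_prod.1 h).2), hRout z hz2]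
  -- ## Lebesgue points of `U(τ) = ∫ W(τ, x) dx`
  set U : ℝ → ℝ := fun τ => ∫ x, W (τ, x) with hU
  have hIW' : Integrable W ((volume : Measure ℝ).prod (volume : Measure E)) := by rw [← Measure.volume_eq_prod]; exact hIW
  have hIU : Integrable U (volume : Measure ℝ) := hIW'.integral_prod_left
  have hUeq : ∀ τ ∈ Icc a' b', U τ = ∫ x, χ x * ‖u τ x‖ ^ 2 := fun τ hτ => by
    simp only [hU]
    exact integral_congr_ae (Eventually.of_forall fun x => hWF (τ, x) hτ)
  have hLeb := IsUnifLocDoublingMeasure.ae_tendsto_average_norm_sub (μ := (volume : Measure ℝ)) hIU.locallyIntegrable 2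
  have hLebN : ∀ᵐ τ ∂(volume : Measure ℝ), ∀ (w δ : ℕ → ℝ), Tendsto δ atTop (𝓝[>] 0) →
      (∀ᶠ j in atTop, τ ∈ closedBall (w j) (2 * δ j)) →
      Tendsto (fun j => ⨍ y in closedBall (w j) (δ j), ‖U y - U τ‖ ∂volume) atTop (𝓝 0) :=
    hLeb.mono fun τ hτ w δ hδ hm => hτ w δ hδ hm
  refine ⟨{τ | ¬ ∀ (w δ : ℕ → ℝ), Tendsto δ atTop (𝓝[>] 0) → (∀ᶠ j in atTop, τ ∈ closedBall (w j) (2 * δ j)) →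
      Tendsto (fun j => ⨍ y in closedBall (w j) (δ j), ‖U y - U τ‖ ∂volume) atTop (𝓝 0)}, ae_iff.1 hLebN, ?_⟩
  intro s σ hsI hσI hsN hσN hsσ
  replace hsN := not_not.1 hsN; replace hσN := not_not.1 hσN
  -- ## the cut-offs at `s` and at `σ`, widths `εₙ = ε₀/(n+1)`, `ε₀ = (s − a')/2`
  obtain ⟨C, -, hcut⟩ := exists_time_cutoff
  set ε₀ : ℝ := (s - a') / 2 with hε₀
  have hε₀pos : 0 < ε₀ := by rw [hε₀]; linarith [hsI.1]
  set ε : ℕ → ℝ := fun n => ε₀ / ((n : ℝ) + 1) with hε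
  have hεpos : ∀ n, 0 < ε n := fun n => by positivity
  have hεle : ∀ n, ε n ≤ ε₀ := fun n => by
    rw [hε]; exact div_le_self hε₀pos.le (by linarith [n.cast_nonneg (α := ℝ)])
  have hε0 : Tendsto ε atTop (𝓝 0) := by
    have := tendsto_one_div_add_atTop_nhds_zero_nat.const_mul ε₀
    rw [mul_zero] at this
    refine this.congr fun n => ?_
    simp only [hε]; ring
  choose η k hηs hη01 hη1 hη0 hηd hkc hkb hks hk1 using fun n => hcut s (ε n) (hεpos n)
  choose η' k' hηs' hη01' hη1' hη0' hηd' hkc' hkb' hks' hk1' using fun n => hcut σ (ε n) (hεpos n)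
  have hk0 : ∀ n τ, τ ∉ Icc (s - 2 * ε n) (s - ε n / 2) → k n τ = 0 := fun n τ hτ => by
    by_contra h; exact hτ (hks n τ h)
  have hk0' : ∀ n τ, τ ∉ Icc (σ - 2 * ε n) (σ - ε n / 2) → k' n τ = 0 := fun n τ hτ => by
    by_contra h; exact hτ (hks' n τ h)
  -- ## the time factors `θₙ = η'ₙ − ηₙ` and the test functions `ζₙ = θₙ χ`
  set θ : ℕ → ℝ → ℝ := fun n τ => η' n τ - η n τ with hθ
  have hθd : ∀ n τ, HasDerivAt (θ n) (k n τ - k' n τ) τ := fun n τ => by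
    have := (hηd' n τ).sub (hηd n τ)
    exact this.congr_deriv (by ring)
  have hθs : ∀ n, ContDiff ℝ (⊤ : ℕ∞) (θ n) := fun n => (hηs' n).sub (hηs n)
  have hθ0 : ∀ n τ, τ ∉ Icc (s - 2 * ε n) (σ - ε n / 2) → θ n τ = 0 := fun n τ hτ => by
    rcases not_and_or.1 (fun h => hτ ⟨h.1, h.2⟩) with h | h
    · have h1 : τ ≤ s - 2 * ε n := (not_le.1 h).le
      simp only [hθ, hη1 n τ h1, hη1' n τ (by linarith), sub_self]
    · have h1 : σ - ε n / 2 ≤ τ := (not_le.1 h).le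
      simp only [hθ, hη0' n τ h1, hη0 n τ (by linarith), sub_self]
  have hθb : ∀ n τ, ‖θ n τ‖ ≤ 2 := fun n τ => by
    rw [Real.norm_eq_abs, hθ]
    have h1 := hη01 n τ; have h2 := hη01' n τ
    rw [abs_le]; constructor <;> linarith
  have hIccn : ∀ n, Icc (s - 2 * ε n) (σ - ε n / 2) ⊆ Ioo a b := fun n τ hτ =>
    ⟨by linarith [hτ.1, hεle n, hsI.1], by linarith [hτ.2, hεpos n, hσI.2]⟩
  set ζ : ℕ → ℝ → E → ℝ := fun n τ x => θ n τ * χ x with hζ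
  have hζtest : ∀ n, IsSpaceTimeTestOn Q (ζ n) := fun n =>
    SuitableRestart.isSpaceTimeTestOn_mul hab (hθs n) (hIccn n) (hθ0 n) hχ hχc
  -- pointwise calculus of `ζₙ`
  have hTD : ∀ n (z : ℝ × E), timeDeriv (ζ n) z.1 z.2 = (k n z.1 - k' n z.1) * χ z.2 := by
    intro n z
    have hd : HasDerivAt (fun τ => ζ n τ z.2) ((k n z.1 - k' n z.1) * χ z.2) z.1 := (hθd n z.1).mul_const _
    rw [timeDeriv, hd.deriv]
  have hgr : ∀ n (z : ℝ × E), gradient (ζ n z.1) z.2 = θ n z.1 • gradient χ z.2 := by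
    intro n z
    have hd : DifferentiableAt ℝ χ z.2 := (hχ.differentiable (by simp)).differentiableAt
    show gradient (fun y => θ n z.1 * χ y) z.2 = _
    rw [gradient, gradient, fderiv_const_mul hd, map_smul]
  -- the integrand of the equality for `ζₙ`, localised to `K`
  have hkW : ∀ n (z : ℝ × E), k n z.1 * F z = k n z.1 * W z := by
    intro n z
    by_cases hkz : k n z.1 = 0
    · rw [hkz, zero_mul, zero_mul]
    · have hz1 := hks n z.1 hkz
      rw [hWF z ⟨by linarith [hz1.1, hεle n, hsI.1], by linarith [hz1.2, hεpos n, hsI.2]⟩]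
  have hkW' : ∀ n (z : ℝ × E), k' n z.1 * F z = k' n z.1 * W z := by
    intro n z
    by_cases hkz : k' n z.1 = 0
    · rw [hkz, zero_mul, zero_mul]
    · have hz1 := hks' n z.1 hkz
      rw [hWF z ⟨by linarith [hz1.1, hεle n, hsI.1, hsσ], by linarith [hz1.2, hεpos n, hσI.2]⟩]
  have hθRK : ∀ n (z : ℝ × E), θ n z.1 * R z = θ n z.1 * RK z := by
    intro n z
    by_cases h1 : z.1 ∈ Icc (s - 2 * ε n) (σ - ε n / 2)
    · rw [hRKR z ⟨by linarith [h1.1, hεle n, hsI.1], by linarith [h1.2, hεpos n, hσI.2]⟩]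
    · rw [hθ0 n z.1 h1, zero_mul, zero_mul]
  -- integrability of the pieces
  have hint_kW : ∀ n, Integrable (fun z : ℝ × E => k n z.1 * W z) (volume : Measure (ℝ × E)) :=
    fun n => hIW.bdd_mul ((hkc n).comp continuous_fst).aestronglyMeasurable
      (Eventually.of_forall fun z => by rw [Real.norm_eq_abs]; exact hkb n z.1)
  have hint_kW' : ∀ n, Integrable (fun z : ℝ × E => k' n z.1 * W z) (volume : Measure (ℝ × E)) :=
    fun n => hIW.bdd_mul ((hkc' n).comp continuous_fst).aestronglyMeasurable
      (Eventually.of_forall fun z => by rw [Real.norm_eq_abs]; exact hkb' n z.1)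
  have hθc : ∀ n, Continuous fun z : ℝ × E => θ n z.1 := fun n => (hθs n).continuous.comp continuous_fst
  have hint_θR : ∀ n, Integrable (fun z : ℝ × E => θ n z.1 * RK z) (volume : Measure (ℝ × E)) :=
    fun n => hIRK.bdd_mul (hθc n).aestronglyMeasurable (Eventually.of_forall fun z => hθb n z.1)
  -- ## the equality for `ζₙ`: `∫ kₙ U − ∫ k'ₙ U + ∫ θₙ RK = 0`
  have hstep : ∀ n, (∫ τ, k n τ * U τ) - (∫ τ, k' n τ * U τ) + ∫ z, θ n z.1 * RK z = 0 := by
    intro n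
    have hL := hcons (ζ n) (hζtest n)
    have hpt : ∀ t x, ‖u t x‖ ^ 2 * timeDeriv (ζ n) t x + (‖u t x‖ ^ 2 + 2 * p t x) * ⟪u t x, gradient (ζ n t) x⟫ =
        k n t * W (t, x) - k' n t * W (t, x) + θ n t * RK (t, x) := by
      intro t x
      rw [hTD n (t, x), hgr n (t, x), real_inner_smul_right]
      have e1 := hkW n (t, x); have e2 := hkW' n (t, x); have e3 := hθRK n (t, x)
      simp only [hF, hR] at e1 e2 e3 ⊢
      linear_combination e1 - e2 + e3
    have hI : Integrable (fun z : ℝ × E => k n z.1 * W z - k' n z.1 * W z + θ n z.1 * RK z) (volume : Measure (ℝ × E)) :=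
      ((hint_kW n).sub (hint_kW' n)).add (hint_θR n)
    have e : (∫ t, ∫ x, (‖u t x‖ ^ 2 * timeDeriv (ζ n) t x + (‖u t x‖ ^ 2 + 2 * p t x) * ⟪u t x, gradient (ζ n t) x⟫)) =
        ∫ z, (k n z.1 * W z - k' n z.1 * W z + θ n z.1 * RK z) := by
      rw [Measure.volume_eq_prod, integral_prod _ hI]
      refine integral_congr_ae (Eventually.of_forall fun t => integral_congr_ae (Eventually.of_forall fun x => hpt t x))
    have hI1 : Integrable (fun z : ℝ × E => k n z.1 * W z - k' n z.1 * W z) (volume : Measure (ℝ × E)) :=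
      (hint_kW n).sub (hint_kW' n)
    rw [e, integral_add hI1 (hint_θR n), integral_sub (hint_kW n) (hint_kW' n)] at hL
    have eW : ∀ κ : ℝ → ℝ, Integrable (fun z : ℝ × E => κ z.1 * W z) (volume : Measure (ℝ × E)) →
        ∫ z, κ z.1 * W z = ∫ τ, κ τ * U τ := fun κ hκ => by
      rw [Measure.volume_eq_prod, integral_prod _ hκ]
      exact integral_congr_ae (Eventually.of_forall fun τ => by simp only [hU, ← integral_const_mul])
    rwa [eW _ (hint_kW n), eW _ (hint_kW' n)] at hL
  -- ## the limits
  have hlimU : Tendsto (fun n => ∫ τ, k n τ * U τ) atTop (𝓝 (U s)) :=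
    tendsto_integral_kernel_mul_of_lebesguePoint hIU hsN hεpos hε0 hkc hkb hks hk1
  have hlimU' : Tendsto (fun n => ∫ τ, k' n τ * U τ) atTop (𝓝 (U σ)) :=
    tendsto_integral_kernel_mul_of_lebesguePoint hIU hσN hεpos hε0 hkc' hkb' hks' hk1'
  have hlimR : Tendsto (fun n => ∫ z, θ n z.1 * RK z) atTop (𝓝 (∫ z, (Ico s σ ×ˢ (univ : Set E)).indicator RK z)) := by
    refine tendsto_integral_of_dominated_convergence (fun z => 2 * ‖RK z‖)
      (fun n => (hint_θR n).aestronglyMeasurable) (hIRK.norm.const_mul 2)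
      (fun n => Eventually.of_forall fun z => ?_) (Eventually.of_forall fun z => ?_)
    · rw [norm_mul]
      exact mul_le_mul_of_nonneg_right (hθb n z.1) (norm_nonneg _)
    · have h1 := tendsto_cutoff_indicator hεpos hε0 (hη1) (hη0) z.1
      have h2 := tendsto_cutoff_indicator hεpos hε0 (hη1') (hη0') z.1
      have h3 : Tendsto (fun n => θ n z.1 * RK z) atTop
          (𝓝 (((Iio σ).indicator (fun _ => (1 : ℝ)) z.1 - (Iio s).indicator (fun _ => (1 : ℝ)) z.1) * RK z)) :=
        (h2.sub h1).mul_const _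
      have hv : ((Iio σ).indicator (fun _ => (1 : ℝ)) z.1 - (Iio s).indicator (fun _ => (1 : ℝ)) z.1) * RK z =
          (Ico s σ ×ˢ (univ : Set E)).indicator RK z := by
        by_cases hzs : z.1 < s
        · have hzσ : z.1 < σ := hzs.trans hsσ
          rw [indicator_of_mem (mem_Iio.2 hzσ), indicator_of_mem (mem_Iio.2 hzs), sub_self,
            indicator_of_notMem (fun h => not_le.2 hzs (mem_prod.1 h).1.1), zero_mul]
        · by_cases hzσ : z.1 < σ
          · rw [indicator_of_mem (mem_Iio.2 hzσ), indicator_of_notMem (fun h => hzs (mem_Iio.1 h)), sub_zero, one_mul,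
              indicator_of_mem (show z ∈ Ico s σ ×ˢ (univ : Set E) from mem_prod.2 ⟨⟨not_lt.1 hzs, hzσ⟩, mem_univ _⟩)]
          · rw [indicator_of_notMem (fun h => hzσ (mem_Iio.1 h)), indicator_of_notMem (fun h => hzs (mem_Iio.1 h)), sub_self,
              indicator_of_notMem (fun h => hzσ (mem_prod.1 h).1.2), zero_mul]
      rw [hv] at h3
      exact h3
  -- the limit integral is the integral over `[s, σ) × E` of `R`
  have hlimR' : ∫ z, (Ico s σ ×ˢ (univ : Set E)).indicator RK z = ∫ z in Ico s σ ×ˢ (univ : Set E), R z := by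
    rw [integral_indicator (measurableSet_Ico.prod MeasurableSet.univ)]
    refine setIntegral_congr_fun (measurableSet_Ico.prod MeasurableSet.univ) fun z hz => ?_
    exact hRKR z ⟨by linarith [(mem_prod.1 hz).1.1, hsI.1], by linarith [(mem_prod.1 hz).1.2, hσI.2]⟩
  -- ## pass to the limit
  have hlim := (hlimU.sub hlimU').add hlimR
  have hzero : U s - U σ + ∫ z, (Ico s σ ×ˢ (univ : Set E)).indicator RK z = 0 :=
    tendsto_nhds_unique hlim (tendsto_const_nhds.congr fun n => (hstep n).symm)
  rw [hlimR', hUeq s ⟨hsI.1.le, hsI.2.le⟩, hUeq σ ⟨hσI.1.le, hσI.2.le⟩] at hzero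
  linarith

/-- **WINDOW IDENTITY ON THE SLAB from suitability, `|u|³ ∈ L¹_loc` and the energy equality** (exhaustion of `(−∞, 0)` by the windows
`(−(m+2), −1/(m+2))`, `exists_null_window_identity_Ioo` on each, union of the null sets; Fubini `∫_{[s,σ)×E} = ∫_{(s,σ)} ∫`). [folklore] -/
theorem hasWindowIdentity_of_suitable
    {u : ℝ → EuclideanSpace ℝ (Fin 3) → EuclideanSpace ℝ (Fin 3)} {p : ℝ → EuclideanSpace ℝ (Fin 3) → ℝ}
    (hsw : IsSuitableWeakSolutionOn (slab (EuclideanSpace ℝ (Fin 3)) (Set.Iio 0) isOpen_Iio) 0 0 u p)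
    (hu3 : LocallyIntegrableOn (fun z : ℝ × EuclideanSpace ℝ (Fin 3) => ‖u z.1 z.2‖ ^ 3)
      (((slab (EuclideanSpace ℝ (Fin 3)) (Set.Iio 0) isOpen_Iio) : Opens (ℝ × EuclideanSpace ℝ (Fin 3))) :
        Set (ℝ × EuclideanSpace ℝ (Fin 3))) volume)
    (hcons : ∀ φ : ℝ → EuclideanSpace ℝ (Fin 3) → ℝ, IsSpaceTimeTestOn (slab (EuclideanSpace ℝ (Fin 3)) (Set.Iio 0) isOpen_Iio) φ →
      ∫ t, ∫ x, (‖u t x‖ ^ 2 * timeDeriv φ t x + (‖u t x‖ ^ 2 + 2 * p t x) * ⟪u t x, gradient (φ t) x⟫) = 0) :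
    ∀ χ : EuclideanSpace ℝ (Fin 3) → ℝ, ContDiff ℝ (⊤ : ℕ∞) χ → HasCompactSupport χ →
      ∃ N : Set ℝ, volume N = 0 ∧ ∀ s σ : ℝ, s < σ → σ < 0 → s ∉ N → σ ∉ N →
        (∫ x, χ x * ‖u σ x‖ ^ 2) - (∫ x, χ x * ‖u s x‖ ^ 2) =
          ∫ τ in Set.Ioo s σ, ∫ x, (‖u τ x‖ ^ 2 + 2 * p τ x) * ⟪u τ x, gradient χ x⟫ := by
  intro χ hχ hχc
  -- ## compact windows `(−(m+3), 0) ⊇ (−(m+2), −1/(m+2))`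
  have hab : ∀ m : ℕ, Ioo (-((m : ℝ) + 3)) 0 ×ˢ (univ : Set (EuclideanSpace ℝ (Fin 3))) ⊆
      (((slab (EuclideanSpace ℝ (Fin 3)) (Set.Iio 0) isOpen_Iio) : Opens (ℝ × EuclideanSpace ℝ (Fin 3))) :
        Set (ℝ × EuclideanSpace ℝ (Fin 3))) := by
    intro m z hz
    rw [SetLike.mem_coe, mem_slab]
    exact (mem_prod.1 hz).1.2
  have hcore := fun m : ℕ => exists_null_window_identity_Ioo hsw hu3 hcons (hab m) hχ hχc
    (a' := -((m : ℝ) + 2)) (b' := -(1 / ((m : ℝ) + 2))) (by linarith) (by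
      have : (0 : ℝ) < 1 / ((m : ℝ) + 2) := by positivity
      linarith)
  choose N hN0 hN using hcore
  refine ⟨⋃ m, N m, measure_iUnion_null hN0, fun s σ hsσ hσ0 hsN hσN => ?_⟩
  -- pick a window containing `s` and `σ`
  obtain ⟨m, hm⟩ : ∃ m : ℕ, -s < (m : ℝ) + 2 ∧ -(1 / σ) < (m : ℝ) + 2 := by
    obtain ⟨m, hm⟩ := exists_nat_gt (max (-s) (-(1 / σ)))
    exact ⟨m, by linarith [le_max_left (-s) (-(1 / σ)), hm], by linarith [le_max_right (-s) (-(1 / σ)), hm]⟩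
  have hm2 : (0 : ℝ) < (m : ℝ) + 2 := by positivity
  have hσb : σ < -(1 / ((m : ℝ) + 2)) := by
    -- `σ < 0`, `−1/σ < m+2` ⇒ `σ < −1/(m+2)`
    have hσ' : 0 < -σ := neg_pos.2 hσ0
    have h1 : 1 / (-σ) < (m : ℝ) + 2 := by rw [one_div_neg_eq_neg_one_div]; exact hm.2
    have h2 : 1 < ((m : ℝ) + 2) * (-σ) := (div_lt_iff₀ hσ').1 h1
    have h3 : 1 / ((m : ℝ) + 2) < -σ := by rw [div_lt_iff₀ hm2, mul_comm]; exact h2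
    linarith
  have hsI : s ∈ Ioo (-((m : ℝ) + 2)) (-(1 / ((m : ℝ) + 2))) := ⟨by linarith [hm.1], hsσ.trans hσb⟩
  have hσI : σ ∈ Ioo (-((m : ℝ) + 2)) (-(1 / ((m : ℝ) + 2))) := ⟨by linarith [hm.1], hσb⟩
  have hid := hN m s σ hsI hσI (fun h => hsN (mem_iUnion.2 ⟨m, h⟩)) (fun h => hσN (mem_iUnion.2 ⟨m, h⟩)) hsσ
  rw [hid]
  -- ## `∫_{[s,σ) × E} R = ∫_{(s,σ)} ∫ R`
  set R : ℝ × EuclideanSpace ℝ (Fin 3) → ℝ := fun z => (‖u z.1 z.2‖ ^ 2 + 2 * p z.1 z.2) * ⟪u z.1 z.2, gradient χ z.2⟫ with hR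
  have hRI : IntegrableOn R (Icc s σ ×ˢ (univ : Set (EuclideanSpace ℝ (Fin 3)))) volume := by
    have h := SuitableRestart.integrableOn_energyRHS_Icc_prod hsw hu3 (hab m) hχ hχc (c₁ := s) (c₂ := σ)
      (fun t ht => ⟨by linarith [ht.1, hm.1], by linarith [ht.2]⟩)
    refine h.congr_fun (fun z _ => ?_) (measurableSet_Icc.prod MeasurableSet.univ)
    simp only [hR, zero_mul, mul_zero, zero_add]
  have hRI' : Integrable R ((volume.restrict (Ioo s σ)).prod (volume : Measure (EuclideanSpace ℝ (Fin 3)))) := by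
    have h := hRI.mono_set (Set.prod_mono Ioo_subset_Icc_self Subset.rfl)
    rw [IntegrableOn, Measure.volume_eq_prod, ← Measure.prod_restrict, Measure.restrict_univ] at h
    exact h
  rw [Measure.volume_eq_prod, ← Measure.prod_restrict, Measure.restrict_univ,
    Measure.restrict_congr_set (Ioo_ae_eq_Ico (μ := (volume : Measure ℝ))).symm]
  exact integral_prod _ hRI'


/-- **WINDOW IDENTITY OF CONSERVATIVE MEMBERS** (`stub_windowIdentity` of line `lions_gate`, BY NAME: the three predicate bodies verbatim; of the class only
suitability and the `E`-gauge are used — `|u|³ ∈ L¹_loc`, `locallyIntegrableOn_cube_of_gauge`). [folklore] -/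
theorem hasWindowIdentity_of_isEnergyConservative {ρ : ℝ}
    {u : ℝ → EuclideanSpace ℝ (Fin 3) → EuclideanSpace ℝ (Fin 3)} {p : ℝ → EuclideanSpace ℝ (Fin 3) → ℝ}
    {H : ℝ → EuclideanSpace ℝ (Fin 3) → EuclideanSpace ℝ (Fin 3) →L[ℝ] EuclideanSpace ℝ (Fin 3)} {c : ℝ≥0}
    (hcls : IsSuitableWeakSolutionOn (slab (EuclideanSpace ℝ (Fin 3)) (Set.Iio 0) isOpen_Iio) 0 0 u p ∧
      HasWeakSpatialGradientOn (slab (EuclideanSpace ℝ (Fin 3)) (Set.Iio 0) isOpen_Iio) u H ∧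
      (∀ a : ℝ, 0 < a →
        ENNReal.ofReal (a ^ (2 * ρ)) * cknA a (0 : ℝ × EuclideanSpace ℝ (Fin 3)) u +
            ENNReal.ofReal (a ^ ρ) * cknE a (0 : ℝ × EuclideanSpace ℝ (Fin 3)) H +
          ENNReal.ofReal (a ^ (2 * ρ)) * cknD a (0 : ℝ × EuclideanSpace ℝ (Fin 3)) p ≤ (c : ℝ≥0∞)))
    (hcons : ∀ φ : ℝ → EuclideanSpace ℝ (Fin 3) → ℝ, IsSpaceTimeTestOn (slab (EuclideanSpace ℝ (Fin 3)) (Set.Iio 0) isOpen_Iio) φ →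
      ∫ t, ∫ x, (‖u t x‖ ^ 2 * timeDeriv φ t x + (‖u t x‖ ^ 2 + 2 * p t x) * ⟪u t x, gradient (φ t) x⟫) = 0) :
    ∀ χ : EuclideanSpace ℝ (Fin 3) → ℝ, ContDiff ℝ (⊤ : ℕ∞) χ → HasCompactSupport χ →
      ∃ N : Set ℝ, volume N = 0 ∧ ∀ s σ : ℝ, s < σ → σ < 0 → s ∉ N → σ ∉ N →
        (∫ x, χ x * ‖u σ x‖ ^ 2) - (∫ x, χ x * ‖u s x‖ ^ 2) =
          ∫ τ in Set.Ioo s σ, ∫ x, (‖u τ x‖ ^ 2 + 2 * p τ x) * ⟪u τ x, gradient χ x⟫ := by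
  obtain ⟨hsw, hH, hgauge⟩ := hcls
  have hE : ∀ a : ℝ, 0 < a → ENNReal.ofReal (a ^ ρ) * cknE a (0 : ℝ × EuclideanSpace ℝ (Fin 3)) H ≤ (c : ℝ≥0∞) :=
    fun a ha => le_trans (le_add_self.trans le_self_add) (hgauge a ha)
  exact hasWindowIdentity_of_suitable hsw (locallyIntegrableOn_cube_of_gauge hsw hH hE) hcons

/-! ## Classical members are conservative; the self-similar needle has the window identity -/

/-- **CLASSICAL MEMBERS ARE CONSERVATIVE** (CKN 1982 §2, "(2.5) holds with equality if `u` is smooth"; tree `local_energy_eq_of_contDiffOn`, `ν = 0`,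
`f = 0`): `u ∈ C²`, `p ∈ C¹` jointly on `(−∞,0) × ℝ³`, `∂ₜu + (u·∇)u + ∇p = 0`, `div u = 0` ⇒ the body of `IsEnergyConservative u p`. [folklore] -/
theorem isEnergyConservative_of_contDiffOn
    {u : ℝ → EuclideanSpace ℝ (Fin 3) → EuclideanSpace ℝ (Fin 3)} {p : ℝ → EuclideanSpace ℝ (Fin 3) → ℝ}
    (hu : ContDiffOn ℝ 2 (uncurry u) (Iio (0 : ℝ) ×ˢ (univ : Set (EuclideanSpace ℝ (Fin 3)))))
    (hp : ContDiffOn ℝ 1 (uncurry p) (Iio (0 : ℝ) ×ˢ (univ : Set (EuclideanSpace ℝ (Fin 3)))))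
    (hmom : ∀ t < (0 : ℝ), ∀ x, timeDeriv u t x + convect (u t) (u t) x + gradient (p t) x = 0)
    (hdiv : ∀ t < (0 : ℝ), VectorCalculus.IsDivFree (u t)) :
    ∀ φ : ℝ → EuclideanSpace ℝ (Fin 3) → ℝ, IsSpaceTimeTestOn (slab (EuclideanSpace ℝ (Fin 3)) (Set.Iio 0) isOpen_Iio) φ →
      ∫ t, ∫ x, (‖u t x‖ ^ 2 * timeDeriv φ t x + (‖u t x‖ ^ 2 + 2 * p t x) * ⟪u t x, gradient (φ t) x⟫) = 0 := by
  intro φ hφ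
  have h := local_energy_eq_of_contDiffOn (Q := slab (EuclideanSpace ℝ (Fin 3)) (Set.Iio 0) isOpen_Iio) (ν := 0)
    (f := fun _ _ => (0 : EuclideanSpace ℝ (Fin 3))) isOpen_Iio (by rw [coe_slab]) hu hp (by exact continuousOn_const)
    (fun t ht x => ?_) (fun t ht => hdiv t (mem_Iio.1 ht)) hφ
  · simp only [mul_zero, zero_mul, add_zero, inner_zero_left] at h
    exact h.symm
  · rw [zero_smul, zero_sub, add_zero, eq_neg_iff_add_eq_zero]
    exact hmom t (mem_Iio.1 ht) x

/-- **CLASSICAL MEMBERS HAVE THE WINDOW IDENTITY** (classical ⇒ suitable, `isSuitableWeakSolutionOn_of_contDiffOn`; `|u|³ ∈ L¹_loc` by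
continuity; classical ⇒ conservative, `isEnergyConservative_of_contDiffOn`; then `hasWindowIdentity_of_suitable`). [folklore] -/
theorem hasWindowIdentity_of_contDiffOn
    {u : ℝ → EuclideanSpace ℝ (Fin 3) → EuclideanSpace ℝ (Fin 3)} {p : ℝ → EuclideanSpace ℝ (Fin 3) → ℝ}
    (hu : ContDiffOn ℝ 2 (uncurry u) (Iio (0 : ℝ) ×ˢ (univ : Set (EuclideanSpace ℝ (Fin 3)))))
    (hp : ContDiffOn ℝ 1 (uncurry p) (Iio (0 : ℝ) ×ˢ (univ : Set (EuclideanSpace ℝ (Fin 3)))))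
    (hmom : ∀ t < (0 : ℝ), ∀ x, timeDeriv u t x + convect (u t) (u t) x + gradient (p t) x = 0)
    (hdiv : ∀ t < (0 : ℝ), VectorCalculus.IsDivFree (u t)) :
    ∀ χ : EuclideanSpace ℝ (Fin 3) → ℝ, ContDiff ℝ (⊤ : ℕ∞) χ → HasCompactSupport χ →
      ∃ N : Set ℝ, volume N = 0 ∧ ∀ s σ : ℝ, s < σ → σ < 0 → s ∉ N → σ ∉ N →
        (∫ x, χ x * ‖u σ x‖ ^ 2) - (∫ x, χ x * ‖u s x‖ ^ 2) =
          ∫ τ in Set.Ioo s σ, ∫ x, (‖u τ x‖ ^ 2 + 2 * p τ x) * ⟪u τ x, gradient χ x⟫ := by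
  have hsw : IsSuitableWeakSolutionOn (slab (EuclideanSpace ℝ (Fin 3)) (Set.Iio 0) isOpen_Iio) 0 0 u p := by
    refine isSuitableWeakSolutionOn_of_contDiffOn (S := Iio (0 : ℝ)) isOpen_Iio (by rw [coe_slab]) hu hp
      (by exact continuousOn_const) (fun t ht x => ?_) (fun t ht => hdiv t (mem_Iio.1 ht))
    rw [zero_smul, zero_sub]
    change timeDeriv u t x + convect (u t) (u t) x = -gradient (p t) x + 0
    rw [add_zero, eq_neg_iff_add_eq_zero]
    exact hmom t (mem_Iio.1 ht) x
  have hu3 : LocallyIntegrableOn (fun z : ℝ × EuclideanSpace ℝ (Fin 3) => ‖u z.1 z.2‖ ^ 3)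
      (((slab (EuclideanSpace ℝ (Fin 3)) (Set.Iio 0) isOpen_Iio) : Opens (ℝ × EuclideanSpace ℝ (Fin 3))) :
        Set (ℝ × EuclideanSpace ℝ (Fin 3))) volume := by
    rw [coe_slab]
    exact (hu.continuousOn.norm.pow 3).locallyIntegrableOn (measurableSet_Iio.prod MeasurableSet.univ)
  exact hasWindowIdentity_of_suitable hsw hu3 (isEnergyConservative_of_contDiffOn hu hp hmom hdiv)

/-- **THE SELF-SIMILAR ANSATZ OF A CIV PROFILE IS CONSERVATIVE** (`IsEnergyConservative` body, any clock exponent `γ`): the needle sits inside the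
conservative stratum (O3 of `lions_gate`), never in the rough dissipative residue O4. [folklore] -/
theorem isEnergyConservative_selfSimilarCollapse {γ : ℝ}
    {V : EuclideanSpace ℝ (Fin 3) → EuclideanSpace ℝ (Fin 3)} {P : EuclideanSpace ℝ (Fin 3) → ℝ} (hprof : IsSelfSimilarEulerProfile γ 0 V P) :
    ∀ φ : ℝ → EuclideanSpace ℝ (Fin 3) → ℝ, IsSpaceTimeTestOn (slab (EuclideanSpace ℝ (Fin 3)) (Set.Iio 0) isOpen_Iio) φ →
      ∫ t, ∫ x, (‖selfSimilarCollapse γ 0 V t x‖ ^ 2 * timeDeriv φ t x +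
        (‖selfSimilarCollapse γ 0 V t x‖ ^ 2 + 2 * selfSimilarCollapsePressure γ 0 P t x) *
          ⟪selfSimilarCollapse γ 0 V t x, gradient (φ t) x⟫) = 0 :=
  isEnergyConservative_of_contDiffOn (ProfileMember.contDiffOn_uncurry_selfSimilarCollapse hprof.contDiff_velocity)
    (ProfileMember.contDiffOn_uncurry_selfSimilarCollapsePressure hprof.contDiff_pressure)
    (fun _ ht x => hprof.euler_selfSimilarCollapse (T := 0) ht x)
    (fun _ ht => ProfileMember.isDivFree_selfSimilarCollapse hprof.divFree ht)

/-- **THE SELF-SIMILAR ANSATZ OF A CIV PROFILE HAS THE WINDOW IDENTITY** (`HasWindowIdentity` body, any clock exponent `γ`). [folklore] -/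
theorem hasWindowIdentity_selfSimilarCollapse {γ : ℝ}
    {V : EuclideanSpace ℝ (Fin 3) → EuclideanSpace ℝ (Fin 3)} {P : EuclideanSpace ℝ (Fin 3) → ℝ} (hprof : IsSelfSimilarEulerProfile γ 0 V P) :
    ∀ χ : EuclideanSpace ℝ (Fin 3) → ℝ, ContDiff ℝ (⊤ : ℕ∞) χ → HasCompactSupport χ →
      ∃ N : Set ℝ, volume N = 0 ∧ ∀ s σ : ℝ, s < σ → σ < 0 → s ∉ N → σ ∉ N →
        (∫ x, χ x * ‖selfSimilarCollapse γ 0 V σ x‖ ^ 2) - (∫ x, χ x * ‖selfSimilarCollapse γ 0 V s x‖ ^ 2) =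
          ∫ τ in Set.Ioo s σ, ∫ x, (‖selfSimilarCollapse γ 0 V τ x‖ ^ 2 + 2 * selfSimilarCollapsePressure γ 0 P τ x) *
            ⟪selfSimilarCollapse γ 0 V τ x, gradient χ x⟫ :=
  hasWindowIdentity_of_contDiffOn (ProfileMember.contDiffOn_uncurry_selfSimilarCollapse hprof.contDiff_velocity)
    (ProfileMember.contDiffOn_uncurry_selfSimilarCollapsePressure hprof.contDiff_pressure)
    (fun _ ht x => hprof.euler_selfSimilarCollapse (T := 0) ht x)
    (fun _ ht => ProfileMember.isDivFree_selfSimilarCollapse hprof.divFree ht)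

end WindowIdentity

end Summit.NavierStokesRegularity.NavierStokesRegularity.Theorems.PowerGaugeEulerLiouville
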